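import Mathlib
import Literature.AlgebraicGeometry.Aoki1983.SemiStandard

/-!
# Aoki's `ξ₃₅` has order exactly `2` modulo pairs and standard elements: a kernel certificate (THEOREM H35)

Solo-blind programme on `KontsevichZagierPeriods`, session 58; companion of `SoloBlindFermat39` (the dying class
`a₃₉`) and `SoloBlindAokiXi` (`17·eff₃₅ = ξ₃₅`: the programme's IMMORTAL torsion class `a₃₅ = a_{5,7}` —
Anderson–Das's odd class of the prime pair `{5, 7}`, which survives the one-level calculus at every Fermat level
`≤ 1200` by the certificate's THEOREM Z⁺⁺ — is a unit multiple of Aoki's semi-standard element `ξ₃₅`).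

For the tree's `ξ₃₅ = (1, 2, 16, 17, 21, 22, 30, 31)` (`Literature.AlgebraicGeometry.Aoki1983.xi35`, a Hodge class of
the Fermat sixfold `X⁶₃₅`) this file proves, purely combinatorially:
* `two_xi35_certificate`: **`2·ξ₃₅ + (3,32) + (6,29) + (7,28) + (8,27) + (9,26) + (10,25) + (11,24) + (12,23) + (15,20)
  = σ_{5,1} + σ_{5,2} + σ_{5,3} + σ_{7,1} + σ_{7,2}`** — twice `ξ₃₅` plus nine pairs is the sum of the five standard
  elements `σ_{5,i}` (`i = 1,2,3`), `σ_{7,i}` (`i = 1,2`); so `2·ξ₃₅` IS stably generated by pairs and standard elements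
  (`two_xi35_stably_standard`);
* `xi35_not_stably_standard`: `ξ₃₅` itself is NOT: the number of entries in `W = {1, 6, 29, 34} = ±{1, 6}` is even on
  every pair, every `σ_{5,i}` and every `σ_{7,i}` (`i ∈ ℤ/35`, degenerate ones included) and odd (`= 1`) on `ξ₃₅`.
Hence the class of `ξ₃₅` has order exactly `2` in `B₃₅/(S₃₅ + D₃₅)` — a kernel certificate of the instance `m = 35` of
[Aoki1983, Thm. D, Remark 5.4]: `T₃₅ ≠ 0` modulo `S₃₅ + D₃₅` and `2·T ⊂ S + D` (`μ'(35) = +1`).  In the programme's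
Gamma-language: the square of the Anderson–Das unit `a_{5,7}` is generated by reflection and Gauss multiplication at
level `35` (Das: `2·tors = 0`), the unit itself is not — at level `35` by this parity, and at every level `≤ 1200` by Z⁺⁺.
Contrast `SoloBlindFermat39`: there the order-`2` class is a semi-decomposable sextuple (dies at its own level); here no
Fermat level is known to help ([Aoki1987, p. 388]: "not yet found such a subvariety except for a few cases").  Nothing in
this file asserts algebraicity of any class or bears on `KZPeriodConjecture`.

## References
* [Aoki1983] N. Aoki, Math. Ann. 266 (1983) 23–54, §5 p. 36 (σ_{p,i}), Thm. D and Remark 5.4 p. 38.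
* [Aoki1987] N. Aoki, J. Math. Soc. Japan 39 (1987) 385–396, pp. 387–388.
* Programme files `SoloBlindAokiXi` (`eff35_smul_eq_xi35`), `SoloBlindLevelRaising35`, `SoloBlindGammaValues` (`v35`).
-/

open Literature.AlgebraicGeometry.HodgeTheory
open Literature.AlgebraicGeometry.Aoki1983

namespace Summit.KontsevichZagierPeriods.KontsevichZagierPeriods.Theorems.SoloBlind.Fermat35

/-! ### Standard elements of level `35` -/

/-- Aoki's standard element `σ_{7,i} = (i, i+5, …, i+30, −7 i)` of level `35` (`p = 7`, `d = 5`), as a multiset.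
[cite: Aoki1983, §5 p. 36 (σ_{p,i})] -/
def sigmaSeven (i : ZMod 35) : Multiset (ZMod 35) :=
  (Multiset.range 7).map (fun k : ℕ ↦ i + (k : ZMod 35) * 5) + {-(7 * i)}

/-- The generators of `S₃₅ + D₃₅` in effective form: pairs `{a, −a}`, `σ_{5,i}` (the tree's `sigmaFive 35 i`), `σ_{7,i}`.
[cite: Aoki1983, Thm. D p. 38] -/
def SDGen35 : Set (Multiset (ZMod 35)) :=
  {s | (∃ a : ZMod 35, s = {a, -a}) ∨ (∃ i : ZMod 35, s = sigmaFive 35 i) ∨ (∃ i : ZMod 35, s = sigmaSeven i)}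

/-- The nine pairs of the certificate. [folklore] -/
def ninePairs : Multiset (ZMod 35) :=
  {3, -3} + {6, -6} + {7, -7} + {8, -8} + {9, -9} + {10, -10} + {11, -11} + {12, -12} + {15, -15}

/-- The five standard elements of the certificate: `σ_{5,1} + σ_{5,2} + σ_{5,3} + σ_{7,1} + σ_{7,2}`. [folklore] -/
def fiveStandard : Multiset (ZMod 35) :=
  sigmaFive 35 1 + sigmaFive 35 2 + sigmaFive 35 3 + sigmaSeven 1 + sigmaSeven 2

/-- **The `2`-torsion certificate**: `2·ξ₃₅ + ninePairs = fiveStandard` as multisets mod `35` (`34` entries each side).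
[cite: Aoki1983, Thm. D and Remark 5.4 p. 38, instance m = 35 (explicit witness)] -/
theorem two_xi35_certificate : xi35 + xi35 + ninePairs = fiveStandard := by
  unfold xi35 ninePairs fiveStandard sigmaSeven sigmaFive; decide +kernel

/-- `ninePairs` lies in the monoid generated by pairs and standard elements. [folklore] -/
theorem ninePairs_mem_closure : ninePairs ∈ AddSubmonoid.closure SDGen35 := by
  unfold ninePairs
  refine add_mem (add_mem (add_mem (add_mem (add_mem (add_mem (add_mem (add_mem ?_ ?_) ?_) ?_) ?_) ?_) ?_) ?_) ?_ <;>
    exact AddSubmonoid.subset_closure (Or.inl ⟨_, rfl⟩)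

/-- `fiveStandard` lies in the monoid generated by pairs and standard elements. [folklore] -/
theorem fiveStandard_mem_closure : fiveStandard ∈ AddSubmonoid.closure SDGen35 := by
  unfold fiveStandard
  refine add_mem (add_mem (add_mem (add_mem ?_ ?_) ?_) ?_) ?_
  · exact AddSubmonoid.subset_closure (Or.inr (Or.inl ⟨1, rfl⟩))
  · exact AddSubmonoid.subset_closure (Or.inr (Or.inl ⟨2, rfl⟩))
  · exact AddSubmonoid.subset_closure (Or.inr (Or.inl ⟨3, rfl⟩))
  · exact AddSubmonoid.subset_closure (Or.inr (Or.inr ⟨1, rfl⟩))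
  · exact AddSubmonoid.subset_closure (Or.inr (Or.inr ⟨2, rfl⟩))

/-- **`2·ξ₃₅` is stably generated by pairs and standard elements.** [cite: Aoki1983, Thm. D and Remark 5.4, p. 38] -/
theorem two_xi35_stably_standard :
    ∃ A ∈ AddSubmonoid.closure SDGen35, ∃ B ∈ AddSubmonoid.closure SDGen35, xi35 + xi35 + A = B :=
  ⟨ninePairs, ninePairs_mem_closure, fiveStandard, fiveStandard_mem_closure, two_xi35_certificate⟩

/-! ### Parity: `ξ₃₅` itself is not stably standard -/

/-- The parity functional: the number of entries of `s` in `W = {1, 6, 29, 34} = ±{1, 6}`. [folklore] -/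
def wcount (s : Multiset (ZMod 35)) : ℕ := Multiset.card (s.filter fun x ↦ x = 1 ∨ x = 6 ∨ x = 29 ∨ x = 34)

/-- `wcount` is additive. [folklore] -/
theorem wcount_add (s t : Multiset (ZMod 35)) : wcount (s + t) = wcount s + wcount t := by
  simp [wcount, Multiset.filter_add]

/-- Pairs have even `wcount` (`W = −W`). [folklore] -/
theorem even_wcount_pair : ∀ a : ZMod 35, Even (wcount {a, -a}) := by
  unfold wcount; decide

/-- The standard elements `σ_{5,i}` have even `wcount`, for every `i`. [folklore] -/
theorem even_wcount_sigmaFive : ∀ i : ZMod 35, Even (wcount (sigmaFive 35 i)) := by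
  unfold wcount sigmaFive; decide

/-- The standard elements `σ_{7,i}` have even `wcount`, for every `i`. [folklore] -/
theorem even_wcount_sigmaSeven : ∀ i : ZMod 35, Even (wcount (sigmaSeven i)) := by
  unfold wcount sigmaSeven; decide

/-- Everything in the monoid generated by pairs and standard elements has even `wcount`. [folklore] -/
theorem even_wcount_of_mem_closure {s : Multiset (ZMod 35)} (h : s ∈ AddSubmonoid.closure SDGen35) :
    Even (wcount s) := by
  induction h using AddSubmonoid.closure_induction with
  | mem x hx =>
    rcases hx with ⟨a, rfl⟩ | ⟨i, rfl⟩ | ⟨i, rfl⟩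
    · exact even_wcount_pair a
    · exact even_wcount_sigmaFive i
    · exact even_wcount_sigmaSeven i
  | zero => exact ⟨0, rfl⟩
  | add x y _ _ hx hy => rw [wcount_add]; exact hx.add hy

/-- `wcount ξ₃₅ = 1` is odd. [folklore] -/
theorem odd_wcount_xi35 : wcount xi35 = 1 := by
  unfold wcount xi35; decide

/-- **`ξ₃₅` is not stably generated by pairs and standard elements**: no `A`, `B` in the monoid generated by
`{a,−a}`, `σ_{5,i}`, `σ_{7,i}` satisfy `ξ₃₅ + A = B`.  With `two_xi35_stably_standard`: the class of `ξ₃₅` has order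
exactly `2` modulo `S₃₅ + D₃₅` — it generates `T₃₅` [Aoki1983, Thm. D].  [cite: Aoki1983, Thm. D and Remark 5.4, p. 38] -/
theorem xi35_not_stably_standard :
    ¬ ∃ A ∈ AddSubmonoid.closure SDGen35, ∃ B ∈ AddSubmonoid.closure SDGen35, xi35 + A = B := by
  rintro ⟨A, hA, B, hB, h⟩
  have hw := congrArg wcount h
  rw [wcount_add, odd_wcount_xi35] at hw
  obtain ⟨a, ha⟩ := even_wcount_of_mem_closure hA
  obtain ⟨b, hb⟩ := even_wcount_of_mem_closure hB
  omega

end Summit.KontsevichZagierPeriods.KontsevichZagierPeriods.Theorems.SoloBlind.Fermat35
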